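import Literature.NumberTheory.Automorphic.ArchRankOneCasimirTorusPoint          -- ★ Z1 p843784: boosts, torus-point jets, `casimir_conj_eq`
import Literature.NumberTheory.Automorphic.ArchConjugationCurveIntegralDeriv      -- ★ Z2 p843797: first ∕ second `s`-derivative of `∫ f(h c(s) h⁻¹) dμ` under the integral sign
import Literature.NumberTheory.Automorphic.ArchLocalTorusOrbitalContinuity        -- ★ `isCompact_setOf_exists_conj_circleDiagonal_mem` (joint properness over the regular set)
import Literature.NumberTheory.Automorphic.ArchTorusOrbitalFubiniSmooth           -- ★ `isCompact_setOf_coe_archLocal_mem` (properness of `G_w ↪ M_N(ℂ)`)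
import Literature.NumberTheory.Automorphic.ArchLocalTorusOrbitalDeriv             -- ★ `coe_conj_archLocal`
import Mathlib.MeasureTheory.Group.Integral
import HarnessLib

/-!
# Boost jets of orbital integrals on `U(e₀,e₁)` (`e₀e₁ < 0`): right-invariance kills them, and at a torus point they read off the Casimir (Varadarajan 1989 §6.3)

Topic `NumberTheory/Automorphic`; namespace `Literature.NumberTheory.Automorphic.RankOneCasimir`.  THEOREMS ONLY (no `def`, no instance, no notation, no axiom, no named
fact, no `sorry`).  Cell `pub/hodgecm-mathlib`, ENGINE T1 (crux H413 = `stmt-HodgeConjecture-24833`); ROAD (Z) toward the row (J3-odd)₃ = [Varadarajan1989 §6.4 Thm 24, `r = 1`]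
descended (census `CENSUS-J3odd3-InHouse.A-p18g25.md` 7db511ac), FILE Z3 of five, PART (a) (the sequel `ArchRankOneCasimirRadialEquation` integrates it into the radial
differential equation `sin²ψ·(O_{Ωf} + O″) + 2 sin ψ cos ψ·O′ = 0`).  Author A-p18 (g26), 2026-09-01, on the g25 recipe `HANDOFF-Z3-RadialODE.A-p18g25.md`.

SETTING.  `G₂ = archLocal L 2 (diag a) w = U(σ_w diag a)(ℂ) ≤ GL₂(ℂ)` (`a_i ≠ 0`; with `e_i = σ_w a_i` real, `q²e₁ = −e₀`, `pq = 1` one has `e₀e₁ < 0`, `G₂ ≅ U(1,1)`), `μ` a measure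
on `G₂` finite on compacta and RIGHT-invariant (every Haar measure: `G₂` is unimodular, ★ `modularCharacterFun_archLocal_eq_one` + ★ `isMulRightInvariant_of_modularCharacterFun_eq_one`),
`f ∈ C²_c(M₂(ℂ), E)`, `X₁ = diag(i,−i)`, `X̂₂ = [[0,p],[q,0]]`, `X̂₃ = [[0,−ip],[iq,0]]` (★ Z1), `T = ↑↑h`, `T′ = ↑↑h⁻¹` for `h ∈ G₂`.

WHAT IS PROVED.
* §0 bookkeeping: `↑↑(h · t_ψ · h⁻¹) = ↑↑h · diag(z e^{iψ}, z e^{−iψ}) · ↑↑h⁻¹`; regularity `z e^{iψ} ≠ z e^{−iψ}` from `sin ψ ≠ 0`.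
* §1 `exists_boost`: the boosts `u(s) = ch s·1 + sh s·X` (`X² = 1`, `XᴴH = −HX`) as a continuous curve `U : ℝ → G₂` with `↑↑(U s)⁻¹ = u(−s)` (★ Z1 `star_boost_mul_mul_boost`).
* §2 `isCompact_setOf_conj_diagonal_mem`: `{h ∈ G₂ | ↑↑h·diag(ζ)·↑↑h⁻¹ ∈ C}` is compact for `ζ` regular, `C ⊆ M₂(ℂ)` compact (★ joint properness + ★ properness of `G_w ↪ M₂(ℂ)`).
* §3 **`integral_boostJet_eq_zero`**: RIGHT-INVARIANCE KILLS THE BOOST JETS — `∫ {D²f(TγT′)[T(Xγ − γX)T′]² + Df(TγT′)[T(2γ − 2XγX)T′]} dμ = 0` for every boost generator `X`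
  and every regular torus point `γ = diag(ζ)`: `A(s) = ∫ f(T u(s)γu(−s) T′) dμ = ∫ f((hU_s)γ(hU_s)⁻¹) dμ` is constant in `s` (`integral_mul_right_eq_self`), while ★ Z2 differentiates
  it twice under the integral sign (compact carrier: §2 translated by `U_s`, `|s| ≤ 1`); `Xγ − γX = c′(0)`, `2γ − 2XγX = c″(0)` (★ Z1).
* §4 **`boost_jets_sum_eq_radial`** (pure algebra; any continuous `ℝ`-bilinear `B` and `ℝ`-linear `ℓ`, any `T, T′` with `TT′ = 1`, `TᴴHT = H`, `M = diag(z e^{iψ}, z e^{−iψ})`):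
  `Σ_{X̂ = X̂₂, X̂₃} [B(T(X̂M − MX̂)T′)² + ℓ(T(2M − 2X̂MX̂)T′)] = (2 − 2cos 2ψ) • (Ω_{B,ℓ}(TMT′) + [B(T(MX₁)T′)² + ℓ(T(MX₁X₁)T′)]) + (4 sin 2ψ) • ℓ(T(MX₁)T′)` with
  `Ω_{B,ℓ}(Y) = −(B(YX₁)² + ℓ(YX₁X₁)) + (B(YX̂₂)² + ℓ(YX̂₂X̂₂)) + (B(YX̂₃)² + ℓ(YX̂₃X̂₃))` the Casimir seen by `(B, ℓ)` — ★ Z1 §3 (torus-point jets with REAL coefficients),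
  ★ Z1 `casimir_conj_eq` (`Ad(U(H))`-invariance of the Casimir seen by `(A,C) ↦ B(YA, YC)`, `Y·TXT′ = T(MX)T′`), `X₁² = −1`, `X̂_k² = 1`, `(C−1)² + S² = 2 − 2C`.
HONEST LABEL: elementary real analysis and `2 × 2` algebra; pays nothing by itself (HC_CM is proved only modulo the printed citations until rung 0 closes).

## References
* [Varadarajan1989] V. S. Varadarajan, *An Introduction to Harmonic Analysis on Semisimple Lie Groups* (1989), §6.3 (radial component of `Ω` on the regular elliptic set), §6.4
  Thms 22–24.
* [Folland1995] G. B. Folland, *A Course in Abstract Harmonic Analysis* (1995), §2.6 (invariant integration; differentiation under Haar integrals).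
* [Hall2015] B. C. Hall, *Lie Groups, Lie Algebras, and Representations*, 2nd ed., GTM 222 (2015), §3.6, Prop. 3.24.
* [Rogawski1990] J. D. Rogawski, *Automorphic Representations of Unitary Groups in Three Variables*, Ann. of Math. Stud. 123 (1990), §8.2 pp. 119–123, §8.3 p. 122.
-/

set_option autoImplicit false

namespace Literature.NumberTheory.Automorphic.RankOneCasimir

open _root_.Complex _root_.Matrix _root_.MeasureTheory _root_.Set _root_.Filter _root_.Topology _root_.NumberField _root_.NumberField.InfinitePlace
open _root_.Literature.NumberTheory.Automorphic.UnitaryGroup _root_.Literature.NumberTheory.Automorphic.ConjugationCurve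
open scoped Matrix.Norms.Operator MatrixGroups ComplexConjugate

variable (L : Type) [Field L] (a : Fin 2 → L) (w : {w : InfinitePlace L // IsComplex w})

/-! ## §0 Bookkeeping: the torus point as a matrix; regularity from `sin ψ ≠ 0` -/

/-- The circle vector `(z e^{iψ}, z e^{−iψ})` coerced to `ℂ²`. [cite: Varadarajan1989, §6.4] -/
theorem coe_torusVec (z : Circle) (ψ : ℝ) :
    (fun i => ((![z * Circle.exp ψ, z * Circle.exp (-ψ)] i : Circle) : ℂ)) = ![(z : ℂ) * cexp (ψ * I), (z : ℂ) * cexp (-(ψ * I))] := by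
  funext i
  fin_cases i
  · simp only [Fin.zero_eta, Fin.isValue, Matrix.cons_val_zero, Circle.coe_mul, Circle.coe_exp]
  · simp only [Fin.mk_one, Fin.isValue, Matrix.cons_val_one, Matrix.cons_val_zero, Circle.coe_mul, Circle.coe_exp]
    push_cast
    rw [neg_mul]

/-- `↑↑(h · t_ψ · h⁻¹) = ↑↑h · diag(z e^{iψ}, z e^{−iψ}) · ↑↑h⁻¹` in `M₂(ℂ)`, `t_ψ` the torus point of `G₂ = archLocal L 2 (diag a) w`. [cite: Rogawski1990, §8.2 p. 119] -/
theorem coe_conj_torusPoint (h : archLocal L 2 (Matrix.diagonal a) w) (z : Circle) (ψ : ℝ) :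
    ((((h * ⟨circleDiagonal 2 ![z * Circle.exp ψ, z * Circle.exp (-ψ)], circleDiagonal_mem_archLocal_diagonal L 2 a w _⟩ * h⁻¹ :
        archLocal L 2 (Matrix.diagonal a) w) : GL (Fin 2) ℂ) : Matrix (Fin 2) (Fin 2) ℂ)) =
      ((h : GL (Fin 2) ℂ) : Matrix (Fin 2) (Fin 2) ℂ) * Matrix.diagonal ![(z : ℂ) * cexp (ψ * I), (z : ℂ) * cexp (-(ψ * I))] *
        (((h⁻¹ : archLocal L 2 (Matrix.diagonal a) w) : GL (Fin 2) ℂ) : Matrix (Fin 2) (Fin 2) ℂ) := by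
  rw [coe_conj_archLocal, ← coe_torusVec]
  rfl

/-- A torus point with `sin ψ ≠ 0` is regular: `z e^{iψ} ≠ z e^{−iψ}`. [cite: Varadarajan1989, §6.4] -/
theorem torusPoint_ne (z : Circle) {ψ : ℝ} (hψ : Real.sin ψ ≠ 0) : z * Circle.exp ψ ≠ z * Circle.exp (-ψ) := by
  intro h
  have h' := mul_left_cancel h
  rw [Circle.exp_eq_exp] at h'
  obtain ⟨m, hm⟩ := h'
  have hψm : ψ = m * Real.pi := by linarith
  rw [hψm, Real.sin_int_mul_pi] at hψ
  exact hψ rfl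

/-! ## §1 The boosts as a continuous curve in `G₂` -/

/-- **The boost curve in `G₂`**: for `X² = 1` and `XᴴH = −HX` (`H = σ_w diag a`) there is a continuous `U : ℝ → G₂` with `↑↑(U s) = ch s·1 + sh s·X` and
`↑↑(U s)⁻¹ = ch s·1 − sh s·X` (★ Z1 `boost_mul_boost_neg`, `star_boost_mul_mul_boost`). [cite: Varadarajan1989, §6.3] -/
theorem exists_boost (X : Matrix (Fin 2) (Fin 2) ℂ) (hXX : X * X = 1)
    (hXH : star X * (Matrix.diagonal a).map w.1.embedding = -((Matrix.diagonal a).map w.1.embedding * X)) :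
    ∃ U : ℝ → archLocal L 2 (Matrix.diagonal a) w, Continuous U ∧ ∀ s : ℝ,
      ((U s : GL (Fin 2) ℂ) : Matrix (Fin 2) (Fin 2) ℂ) = cosh (s : ℂ) • (1 : Matrix (Fin 2) (Fin 2) ℂ) + sinh (s : ℂ) • X ∧
      ((((U s)⁻¹ : archLocal L 2 (Matrix.diagonal a) w) : GL (Fin 2) ℂ) : Matrix (Fin 2) (Fin 2) ℂ) =
        cosh (s : ℂ) • (1 : Matrix (Fin 2) (Fin 2) ℂ) - sinh (s : ℂ) • X := by
  have hch : Continuous fun s : ℝ => cosh (s : ℂ) := Complex.continuous_cosh.comp Complex.continuous_ofReal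
  have hsh : Continuous fun s : ℝ => sinh (s : ℂ) := Complex.continuous_sinh.comp Complex.continuous_ofReal
  -- the unit
  obtain ⟨u, hu⟩ : ∃ u : ℝ → GL (Fin 2) ℂ, u = fun s =>
      ⟨cosh (s : ℂ) • (1 : Matrix (Fin 2) (Fin 2) ℂ) + sinh (s : ℂ) • X, cosh (s : ℂ) • (1 : Matrix (Fin 2) (Fin 2) ℂ) - sinh (s : ℂ) • X,
        boost_mul_boost_neg X hXX s, boost_neg_mul_boost X hXX s⟩ := ⟨_, rfl⟩
  have hval : ∀ s, ((u s : GL (Fin 2) ℂ) : Matrix (Fin 2) (Fin 2) ℂ) = cosh (s : ℂ) • (1 : Matrix (Fin 2) (Fin 2) ℂ) + sinh (s : ℂ) • X := fun s => by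
    rw [hu]
  have hinv : ∀ s, (((u s)⁻¹ : GL (Fin 2) ℂ) : Matrix (Fin 2) (Fin 2) ℂ) = cosh (s : ℂ) • (1 : Matrix (Fin 2) (Fin 2) ℂ) - sinh (s : ℂ) • X := fun s => by
    rw [hu]; rfl
  have hmem : ∀ s, u s ∈ archLocal L 2 (Matrix.diagonal a) w := fun s => by
    rw [mem_archLocal_iff_conjTranspose, hval, ← Matrix.star_eq_conjTranspose]
    exact star_boost_mul_mul_boost X _ hXX hXH s
  have hcont : Continuous u := by
    refine Units.continuous_iff.2 ⟨?_, ?_⟩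
    · show Continuous fun s => ((u s : GL (Fin 2) ℂ) : Matrix (Fin 2) (Fin 2) ℂ)
      simp_rw [hval]; exact (hch.smul continuous_const).add (hsh.smul continuous_const)
    · simp_rw [hinv]; exact (hch.smul continuous_const).sub (hsh.smul continuous_const)
  refine ⟨fun s => ⟨u s, hmem s⟩, hcont.subtype_mk _, fun s => ⟨hval s, ?_⟩⟩
  rw [← hinv s]
  rfl

/-! ## §2 The compact carrier `{h ∈ G₂ | h·diag(ζ)·h⁻¹ ∈ C}` for a regular `ζ` -/

/-- **Compact carrier at a regular torus point**: for `a_i ≠ 0`, `C ⊆ M₂(ℂ)` compact and `ζ ∈ (S¹)²` with `ζ₀ ≠ ζ₁`, the set of `h ∈ G₂` with `↑↑h·diag(ζ)·↑↑h⁻¹ ∈ C` is compact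
(★ `isCompact_setOf_exists_conj_circleDiagonal_mem` with `K = {ζ}` over ★ `isCompact_setOf_coe_archLocal_mem`). [cite: Rogawski1990, §8.3 p. 122] -/
theorem isCompact_setOf_conj_diagonal_mem (ha : ∀ i, a i ≠ 0) {C : Set (Matrix (Fin 2) (Fin 2) ℂ)} (hC : IsCompact C)
    {ζ : Fin 2 → Circle} (hζ : Function.Injective ζ) :
    IsCompact {g : archLocal L 2 (Matrix.diagonal a) w |
      ((g : GL (Fin 2) ℂ) : Matrix (Fin 2) (Fin 2) ℂ) * (Matrix.diagonal fun i => (ζ i : ℂ)) *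
        (((g⁻¹ : archLocal L 2 (Matrix.diagonal a) w) : GL (Fin 2) ℂ) : Matrix (Fin 2) (Fin 2) ℂ) ∈ C} := by
  have hC' := isCompact_setOf_coe_archLocal_mem L 2 a w ha hC
  have h := isCompact_setOf_exists_conj_circleDiagonal_mem L 2 a w ha (K := {ζ}) isCompact_singleton
    (fun v hv => by rw [Set.mem_singleton_iff.1 hv]; exact hζ) hC'
  have hEq : {g : archLocal L 2 (Matrix.diagonal a) w |
      ((g : GL (Fin 2) ℂ) : Matrix (Fin 2) (Fin 2) ℂ) * (Matrix.diagonal fun i => (ζ i : ℂ)) *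
        (((g⁻¹ : archLocal L 2 (Matrix.diagonal a) w) : GL (Fin 2) ℂ) : Matrix (Fin 2) (Fin 2) ℂ) ∈ C} =
      {g : archLocal L 2 (Matrix.diagonal a) w | ∃ v ∈ ({ζ} : Set (Fin 2 → Circle)),
        g * ⟨circleDiagonal 2 v, circleDiagonal_mem_archLocal_diagonal L 2 a w v⟩ * g⁻¹ ∈
          {g : archLocal L 2 (Matrix.diagonal a) w | ((g : GL (Fin 2) ℂ) : Matrix (Fin 2) (Fin 2) ℂ) ∈ C}} := by
    ext g
    simp only [Set.mem_setOf_eq, Set.mem_singleton_iff, exists_eq_left, coe_conj_archLocal, coe_circleDiagonal]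
  rw [hEq]
  exact h


/-! ## §3 Right-invariance of `μ` kills the boost jets -/

section Integral

variable {E : Type*} [NormedAddCommGroup E] [NormedSpace ℝ E] [CompleteSpace E]
variable [MeasurableSpace (archLocal L 2 (Matrix.diagonal a) w)] [BorelSpace (archLocal L 2 (Matrix.diagonal a) w)]

/-- **RIGHT-INVARIANCE KILLS THE BOOST JETS.**  `G₂ = U(σ_w diag a)(ℂ)`, `μ` finite on compacta and right-invariant, `f ∈ C²_c(M₂(ℂ), E)`, `X` a boost generator (`X² = 1`,
`XᴴH = −HX`), `γ = diag(ζ)` a REGULAR torus point (`ζ₀ ≠ ζ₁`).  Then the integrand `h ↦ D²f(hγh⁻¹)[h(Xγ − γX)h⁻¹]² + Df(hγh⁻¹)[h(2γ − 2XγX)h⁻¹]` is integrable and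
integrates to `0`: `A(s) = ∫ f(h·u(s)γu(−s)·h⁻¹) dμ = ∫ f((hU_s)γ(hU_s)⁻¹) dμ` does not depend on `s` (`integral_mul_right_eq_self`), and ★ Z2 computes `A′`, `A″(0)` under
the integral sign (carrier: §2 translated by `U_s`, `|s| ≤ 1`); `Xγ − γX = c′(0)`, `2γ − 2XγX = c″(0)` (★ Z1). [cite: Varadarajan1989, §6.3] [cite: Folland1995, §2.6] -/
theorem integral_boostJet_eq_zero (μ : Measure (archLocal L 2 (Matrix.diagonal a) w)) [IsFiniteMeasureOnCompacts μ] [μ.IsMulRightInvariant]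
    (ha : ∀ i, a i ≠ 0) (f : Matrix (Fin 2) (Fin 2) ℂ → E) (hf : ContDiff ℝ 2 f) (hfc : HasCompactSupport f)
    (X : Matrix (Fin 2) (Fin 2) ℂ) (hXX : X * X = 1) (hXH : star X * (Matrix.diagonal a).map w.1.embedding = -((Matrix.diagonal a).map w.1.embedding * X))
    {ζ : Fin 2 → Circle} (hζ : Function.Injective ζ) {γ : Matrix (Fin 2) (Fin 2) ℂ} (hγ : γ = Matrix.diagonal fun i => (ζ i : ℂ)) :
    Integrable (fun h : archLocal L 2 (Matrix.diagonal a) w =>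
        fderiv ℝ (fderiv ℝ f) (((h : GL (Fin 2) ℂ) : Matrix (Fin 2) (Fin 2) ℂ) * γ * (((h⁻¹ : archLocal L 2 (Matrix.diagonal a) w) : GL (Fin 2) ℂ) : Matrix (Fin 2) (Fin 2) ℂ)) (((h : GL (Fin 2) ℂ) : Matrix (Fin 2) (Fin 2) ℂ) * (X * γ - γ * X) * (((h⁻¹ : archLocal L 2 (Matrix.diagonal a) w) : GL (Fin 2) ℂ) : Matrix (Fin 2) (Fin 2) ℂ)) (((h : GL (Fin 2) ℂ) : Matrix (Fin 2) (Fin 2) ℂ) * (X * γ - γ * X) * (((h⁻¹ : archLocal L 2 (Matrix.diagonal a) w) : GL (Fin 2) ℂ) : Matrix (Fin 2) (Fin 2) ℂ)) +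
          fderiv ℝ f (((h : GL (Fin 2) ℂ) : Matrix (Fin 2) (Fin 2) ℂ) * γ * (((h⁻¹ : archLocal L 2 (Matrix.diagonal a) w) : GL (Fin 2) ℂ) : Matrix (Fin 2) (Fin 2) ℂ)) (((h : GL (Fin 2) ℂ) : Matrix (Fin 2) (Fin 2) ℂ) * ((2 : ℂ) • γ - (2 : ℂ) • (X * γ * X)) * (((h⁻¹ : archLocal L 2 (Matrix.diagonal a) w) : GL (Fin 2) ℂ) : Matrix (Fin 2) (Fin 2) ℂ))) μ ∧
      ∫ h : archLocal L 2 (Matrix.diagonal a) w, (fderiv ℝ (fderiv ℝ f) (((h : GL (Fin 2) ℂ) : Matrix (Fin 2) (Fin 2) ℂ) * γ * (((h⁻¹ : archLocal L 2 (Matrix.diagonal a) w) : GL (Fin 2) ℂ) : Matrix (Fin 2) (Fin 2) ℂ)) (((h : GL (Fin 2) ℂ) : Matrix (Fin 2) (Fin 2) ℂ) * (X * γ - γ * X) * (((h⁻¹ : archLocal L 2 (Matrix.diagonal a) w) : GL (Fin 2) ℂ) : Matrix (Fin 2) (Fin 2) ℂ)) (((h : GL (Fin 2) ℂ) : Matrix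 (Fin 2) (Fin 2) ℂ) * (X * γ - γ * X) * (((h⁻¹ : archLocal L 2 (Matrix.diagonal a) w) : GL (Fin 2) ℂ) : Matrix (Fin 2) (Fin 2) ℂ)) +
          fderiv ℝ f (((h : GL (Fin 2) ℂ) : Matrix (Fin 2) (Fin 2) ℂ) * γ * (((h⁻¹ : archLocal L 2 (Matrix.diagonal a) w) : GL (Fin 2) ℂ) : Matrix (Fin 2) (Fin 2) ℂ)) (((h : GL (Fin 2) ℂ) : Matrix (Fin 2) (Fin 2) ℂ) * ((2 : ℂ) • γ - (2 : ℂ) • (X * γ * X)) * (((h⁻¹ : archLocal L 2 (Matrix.diagonal a) w) : GL (Fin 2) ℂ) : Matrix (Fin 2) (Fin 2) ℂ))) ∂μ = 0 := by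
  obtain ⟨U, hUc, hU⟩ := exists_boost L a w X hXX hXH
  have hch : Continuous fun s : ℝ => cosh (s : ℂ) := Complex.continuous_cosh.comp Complex.continuous_ofReal
  have hsh : Continuous fun s : ℝ => sinh (s : ℂ) := Complex.continuous_sinh.comp Complex.continuous_ofReal
  have hup : Continuous fun s : ℝ => cosh (s : ℂ) • (1 : Matrix (Fin 2) (Fin 2) ℂ) + sinh (s : ℂ) • X := (hch.smul continuous_const).add (hsh.smul continuous_const)
  have hum : Continuous fun s : ℝ => cosh (s : ℂ) • (1 : Matrix (Fin 2) (Fin 2) ℂ) - sinh (s : ℂ) • X := (hch.smul continuous_const).sub (hsh.smul continuous_const)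
  have hup' : Continuous fun s : ℝ => sinh (s : ℂ) • (1 : Matrix (Fin 2) (Fin 2) ℂ) + cosh (s : ℂ) • X := (hsh.smul continuous_const).add (hch.smul continuous_const)
  have hum' : Continuous fun s : ℝ => sinh (s : ℂ) • (1 : Matrix (Fin 2) (Fin 2) ℂ) - cosh (s : ℂ) • X := (hsh.smul continuous_const).sub (hch.smul continuous_const)
  -- the conjugation curve `c(s) = u(s) γ u(−s)` and its jets (★ Z1)
  obtain ⟨c, hc⟩ : ∃ c : ℝ → Matrix (Fin 2) (Fin 2) ℂ, c = fun s : ℝ =>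
      (cosh (s : ℂ) • (1 : Matrix (Fin 2) (Fin 2) ℂ) + sinh (s : ℂ) • X) * γ * (cosh (s : ℂ) • (1 : Matrix (Fin 2) (Fin 2) ℂ) - sinh (s : ℂ) • X) := ⟨_, rfl⟩
  obtain ⟨c₁, hc₁⟩ : ∃ c₁ : ℝ → Matrix (Fin 2) (Fin 2) ℂ, c₁ = fun s : ℝ =>
      (sinh (s : ℂ) • (1 : Matrix (Fin 2) (Fin 2) ℂ) + cosh (s : ℂ) • X) * γ * (cosh (s : ℂ) • (1 : Matrix (Fin 2) (Fin 2) ℂ) - sinh (s : ℂ) • X) +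
        (cosh (s : ℂ) • (1 : Matrix (Fin 2) (Fin 2) ℂ) + sinh (s : ℂ) • X) * γ * (sinh (s : ℂ) • (1 : Matrix (Fin 2) (Fin 2) ℂ) - cosh (s : ℂ) • X) := ⟨_, rfl⟩
  obtain ⟨c₂, hc₂⟩ : ∃ c₂ : ℝ → Matrix (Fin 2) (Fin 2) ℂ, c₂ = fun s : ℝ =>
      ((cosh (s : ℂ) • (1 : Matrix (Fin 2) (Fin 2) ℂ) + sinh (s : ℂ) • X) * γ * (cosh (s : ℂ) • (1 : Matrix (Fin 2) (Fin 2) ℂ) - sinh (s : ℂ) • X) +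
          (sinh (s : ℂ) • (1 : Matrix (Fin 2) (Fin 2) ℂ) + cosh (s : ℂ) • X) * γ * (sinh (s : ℂ) • (1 : Matrix (Fin 2) (Fin 2) ℂ) - cosh (s : ℂ) • X)) +
        ((sinh (s : ℂ) • (1 : Matrix (Fin 2) (Fin 2) ℂ) + cosh (s : ℂ) • X) * γ * (sinh (s : ℂ) • (1 : Matrix (Fin 2) (Fin 2) ℂ) - cosh (s : ℂ) • X) +
          (cosh (s : ℂ) • (1 : Matrix (Fin 2) (Fin 2) ℂ) + sinh (s : ℂ) • X) * γ * (cosh (s : ℂ) • (1 : Matrix (Fin 2) (Fin 2) ℂ) - sinh (s : ℂ) • X)) := ⟨_, rfl⟩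
  have hcd : ∀ s, HasDerivAt c (c₁ s) s := fun s => by rw [hc, hc₁]; exact hasDerivAt_conjBoost X γ s
  have hc₁d : ∀ s, HasDerivAt c₁ (c₂ s) s := fun s => by rw [hc₁, hc₂]; exact hasDerivAt_conjBoost_deriv X γ s
  have hc₁c : Continuous c₁ := continuous_iff_continuousAt.2 fun s => (hc₁d s).continuousAt
  have hc₂c : Continuous c₂ := by
    rw [hc₂]
    exact (((hup.mul continuous_const).mul hum).add ((hup'.mul continuous_const).mul hum')).add
      (((hup'.mul continuous_const).mul hum').add ((hup.mul continuous_const).mul hum))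
  have e0 : c 0 = γ := by rw [hc]; exact conjBoost_zero X γ
  have e1 : c₁ 0 = X * γ - γ * X := by rw [hc₁]; exact conjBoost_deriv_zero X γ
  have e2 : c₂ 0 = (2 : ℂ) • γ - (2 : ℂ) • (X * γ * X) := by rw [hc₂]; exact conjBoost_deriv_deriv_zero X γ
  -- `↑↑(hU_s) γ ↑↑(hU_s)⁻¹ = ↑↑h c(s) ↑↑h⁻¹`
  have hconjU : ∀ (h : archLocal L 2 (Matrix.diagonal a) w) (s : ℝ),
      (((h * U s : archLocal L 2 (Matrix.diagonal a) w) : GL (Fin 2) ℂ) : Matrix (Fin 2) (Fin 2) ℂ) * γ * ((((h * U s)⁻¹ : archLocal L 2 (Matrix.diagonal a) w) : GL (Fin 2) ℂ) : Matrix (Fin 2) (Fin 2) ℂ) =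
        ((h : GL (Fin 2) ℂ) : Matrix (Fin 2) (Fin 2) ℂ) * c s * (((h⁻¹ : archLocal L 2 (Matrix.diagonal a) w) : GL (Fin 2) ℂ) : Matrix (Fin 2) (Fin 2) ℂ) := fun h s => by
    rw [_root_.mul_inv_rev, Subgroup.coe_mul, Subgroup.coe_mul, Units.val_mul, Units.val_mul, (hU s).1, (hU s).2, hc]
    simp only [Matrix.mul_assoc]
  -- the compact carrier `K = K₀ · U([−1,1])⁻¹`, `K₀ = {g | gγg⁻¹ ∈ supp f}` (§2)
  have hK₀ := isCompact_setOf_conj_diagonal_mem L a w ha hfc.isCompact hζ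
  rw [← hγ] at hK₀
  have hK : IsCompact ((fun p : (archLocal L 2 (Matrix.diagonal a) w) × ℝ => p.1 * (U p.2)⁻¹) ''
      ({g : archLocal L 2 (Matrix.diagonal a) w | ((g : GL (Fin 2) ℂ) : Matrix (Fin 2) (Fin 2) ℂ) * γ * (((g⁻¹ : archLocal L 2 (Matrix.diagonal a) w) : GL (Fin 2) ℂ) : Matrix (Fin 2) (Fin 2) ℂ) ∈ tsupport f} ×ˢ
        Metric.closedBall (0 : ℝ) 1)) :=
    (hK₀.prod (isCompact_closedBall (0 : ℝ) 1)).image (continuous_fst.mul (hUc.comp continuous_snd).inv)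
  have hcar : ∀ s ∈ Metric.ball (0 : ℝ) 1, ∀ h : archLocal L 2 (Matrix.diagonal a) w, h ∉ (fun p : (archLocal L 2 (Matrix.diagonal a) w) × ℝ => p.1 * (U p.2)⁻¹) ''
      ({g : archLocal L 2 (Matrix.diagonal a) w | ((g : GL (Fin 2) ℂ) : Matrix (Fin 2) (Fin 2) ℂ) * γ * (((g⁻¹ : archLocal L 2 (Matrix.diagonal a) w) : GL (Fin 2) ℂ) : Matrix (Fin 2) (Fin 2) ℂ) ∈ tsupport f} ×ˢ
        Metric.closedBall (0 : ℝ) 1) → ((h : GL (Fin 2) ℂ) : Matrix (Fin 2) (Fin 2) ℂ) * c s * (((h⁻¹ : archLocal L 2 (Matrix.diagonal a) w) : GL (Fin 2) ℂ) : Matrix (Fin 2) (Fin 2) ℂ) ∉ tsupport f := by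
    intro s hs h hh hmem
    refine hh ⟨(h * U s, s), ⟨?_, Metric.ball_subset_closedBall hs⟩, mul_inv_cancel_right h (U s)⟩
    show (((h * U s : archLocal L 2 (Matrix.diagonal a) w) : GL (Fin 2) ℂ) : Matrix (Fin 2) (Fin 2) ℂ) * γ * ((((h * U s)⁻¹ : archLocal L 2 (Matrix.diagonal a) w) : GL (Fin 2) ℂ) : Matrix (Fin 2) (Fin 2) ℂ) ∈ tsupport f
    rw [hconjU]; exact hmem
  have hball : ∀ s₀ ∈ Metric.ball (0 : ℝ) (1 / 2), ∀ s ∈ Metric.ball s₀ (1 / 2), s ∈ Metric.ball (0 : ℝ) 1 := fun s₀ hs₀ s hs => by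
    rw [Metric.mem_ball, Real.dist_eq] at hs₀ hs ⊢
    rw [sub_zero] at hs₀ ⊢
    calc |s| = |s - s₀ + s₀| := by rw [sub_add_cancel]
      _ ≤ |s - s₀| + |s₀| := abs_add_le _ _
      _ < 1 := by linarith
  -- `A(s) = A(0)`: right-invariance
  have hA : ∀ s, ∫ h : archLocal L 2 (Matrix.diagonal a) w, f (((h : GL (Fin 2) ℂ) : Matrix (Fin 2) (Fin 2) ℂ) * c s * (((h⁻¹ : archLocal L 2 (Matrix.diagonal a) w) : GL (Fin 2) ℂ) : Matrix (Fin 2) (Fin 2) ℂ)) ∂μ = ∫ h : archLocal L 2 (Matrix.diagonal a) w, f (((h : GL (Fin 2) ℂ) : Matrix (Fin 2) (Fin 2) ℂ) * γ * (((h⁻¹ : archLocal L 2 (Matrix.diagonal a) w) : GL (Fin 2) ℂ) : Matrix (Fin 2) (Fin 2) ℂ)) ∂μ := fun s => by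
    rw [← integral_mul_right_eq_self (fun g : archLocal L 2 (Matrix.diagonal a) w => f (((g : GL (Fin 2) ℂ) : Matrix (Fin 2) (Fin 2) ℂ) * γ *
      (((g⁻¹ : archLocal L 2 (Matrix.diagonal a) w) : GL (Fin 2) ℂ) : Matrix (Fin 2) (Fin 2) ℂ))) (U s)]
    refine integral_congr_ae (Eventually.of_forall fun h => ?_)
    show f (((h : GL (Fin 2) ℂ) : Matrix (Fin 2) (Fin 2) ℂ) * c s * (((h⁻¹ : archLocal L 2 (Matrix.diagonal a) w) : GL (Fin 2) ℂ) : Matrix (Fin 2) (Fin 2) ℂ)) = f ((((h * U s : archLocal L 2 (Matrix.diagonal a) w) : GL (Fin 2) ℂ) : Matrix (Fin 2) (Fin 2) ℂ) * γ * ((((h * U s)⁻¹ : archLocal L 2 (Matrix.diagonal a) w) : GL (Fin 2) ℂ) : Matrix (Fin 2) (Fin 2) ℂ))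
    rw [hconjU]
  -- `A′ = 0` on `|s₀| < 1∕2` (★ Z2 (a) vs. the constant)
  have hA' : ∀ s₀ ∈ Metric.ball (0 : ℝ) (1 / 2), ∫ h : archLocal L 2 (Matrix.diagonal a) w, fderiv ℝ f (((h : GL (Fin 2) ℂ) : Matrix (Fin 2) (Fin 2) ℂ) * c s₀ * (((h⁻¹ : archLocal L 2 (Matrix.diagonal a) w) : GL (Fin 2) ℂ) : Matrix (Fin 2) (Fin 2) ℂ)) (((h : GL (Fin 2) ℂ) : Matrix (Fin 2) (Fin 2) ℂ) * c₁ s₀ * (((h⁻¹ : archLocal L 2 (Matrix.diagonal a) w) : GL (Fin 2) ℂ) : Matrix (Fin 2) (Fin 2) ℂ)) ∂μ = 0 := fun s₀ hs₀ => by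
    have h1 := (hasDerivAt_integral_comp_conj_curve (archLocal L 2 (Matrix.diagonal a) w) μ f (hf.of_le (by norm_num)) hcd hc₁c (by norm_num : (0 : ℝ) < 1 / 2) hK
      (fun s hs h hh => hcar s (hball s₀ hs₀ s hs) h hh)).2
    have h2 : HasDerivAt (fun s => ∫ h : archLocal L 2 (Matrix.diagonal a) w, f (((h : GL (Fin 2) ℂ) : Matrix (Fin 2) (Fin 2) ℂ) * c s * (((h⁻¹ : archLocal L 2 (Matrix.diagonal a) w) : GL (Fin 2) ℂ) : Matrix (Fin 2) (Fin 2) ℂ)) ∂μ) 0 s₀ := by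
      have hconst : (fun s => ∫ h : archLocal L 2 (Matrix.diagonal a) w, f (((h : GL (Fin 2) ℂ) : Matrix (Fin 2) (Fin 2) ℂ) * c s * (((h⁻¹ : archLocal L 2 (Matrix.diagonal a) w) : GL (Fin 2) ℂ) : Matrix (Fin 2) (Fin 2) ℂ)) ∂μ) = fun _ => ∫ h : archLocal L 2 (Matrix.diagonal a) w, f (((h : GL (Fin 2) ℂ) : Matrix (Fin 2) (Fin 2) ℂ) * γ * (((h⁻¹ : archLocal L 2 (Matrix.diagonal a) w) : GL (Fin 2) ℂ) : Matrix (Fin 2) (Fin 2) ℂ)) ∂μ := funext hA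
      rw [hconst]; exact hasDerivAt_const s₀ _
    exact h1.unique h2
  -- `A″(0) = 0` (★ Z2 (b) vs. `A′ ≡ 0` near `0`)
  have h3 := hasDerivAt_integral_fderiv_comp_conj_curve (archLocal L 2 (Matrix.diagonal a) w) μ f hf hcd hc₁d hc₂c (by norm_num : (0 : ℝ) < 1 / 2) hK
    (fun s hs h hh => hcar s (hball 0 (Metric.mem_ball_self (by norm_num)) s hs) h hh)
  have h4 : HasDerivAt (fun s => ∫ h : archLocal L 2 (Matrix.diagonal a) w, fderiv ℝ f (((h : GL (Fin 2) ℂ) : Matrix (Fin 2) (Fin 2) ℂ) * c s * (((h⁻¹ : archLocal L 2 (Matrix.diagonal a) w) : GL (Fin 2) ℂ) : Matrix (Fin 2) (Fin 2) ℂ)) (((h : GL (Fin 2) ℂ) : Matrix (Fin 2) (Fin 2) ℂ) * c₁ s * (((h⁻¹ : archLocal L 2 (Matrix.diagonal a) w) : GL (Fin 2) ℂ) : Matrix (Fin 2) (Fin 2) ℂ)) ∂μ) 0 0 := by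
    refine (hasDerivAt_const (0 : ℝ) (0 : E)).congr_of_eventuallyEq ?_
    filter_upwards [Metric.ball_mem_nhds (0 : ℝ) (by norm_num : (0 : ℝ) < 1 / 2)] with s hs
    exact hA' s hs
  have h5 := h3.2.unique h4
  rw [e0, e1, e2] at h3 h5
  exact ⟨h3.1, h5⟩

end Integral

/-! ## §4 The pointwise identity: the boost jets at a torus point against the Casimir and the torus-curve jets -/

section Pointwise

variable {E : Type*} [NormedAddCommGroup E] [NormedSpace ℝ E]

/-- Conjugation distributes over REAL linear combinations: `T(rA + sB)T′ = r•TAT′ + s•TBT′`. [cite: Hall2015, §3.6] -/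
theorem conj_add_smul (T T' A B : Matrix (Fin 2) (Fin 2) ℂ) (r s : ℝ) :
    T * (r • A + s • B) * T' = r • (T * A * T') + s • (T * B * T') := by
  rw [Matrix.mul_add, Matrix.add_mul, Matrix.mul_smul, Matrix.mul_smul, Matrix.smul_mul, Matrix.smul_mul]

/-- **THE POINTWISE RADIAL IDENTITY.**  For every continuous `ℝ`-bilinear `B` and `ℝ`-linear `ℓ` on `M₂(ℂ)`, every `T, T′` with `TT′ = 1`, `TᴴHT = H` (`H = diag(e)` real
nowhere zero, `q²e₁ = −e₀`, `pq = 1`) and the torus point `M = diag(z e^{iψ}, z e^{−iψ})` (`z ∈ ℂ`): the sum over the two boost generators `X̂₂, X̂₃` of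
`B(T(X̂M − MX̂)T′)² + ℓ(T(2M − 2X̂MX̂)T′)` equals `(2 − 2cos 2ψ) • (Ω_{B,ℓ}(TMT′) + [B(T(MX₁)T′)² + ℓ(T(MX₁X₁)T′)]) + (4 sin 2ψ) • ℓ(T(MX₁)T′)`, where
`Ω_{B,ℓ}(Y) = −(B(YX₁)² + ℓ(YX₁X₁)) + (B(YX̂₂)² + ℓ(YX̂₂X̂₂)) + (B(YX̂₃)² + ℓ(YX̂₃X̂₃))` is the Casimir seen by `(B, ℓ)` at `Y`.  Ingredients: ★ Z1 `sum_boost_jets_eq`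
(the jets as REAL combinations of `T(MX̂₂)T′, T(MX̂₃)T′, TMT′, T(MX₁)T′`), ★ Z1 `casimir_conj_eq` (`Ad(U(H))`-invariance of the Casimir seen by `(A,C) ↦ B(YA, YC)`,
`Y = TMT′`, so that `Y·TXT′ = T(MX)T′`), and `X₁² = −1`, `X̂_k² = 1`.  With `B = D²f(Y)`, `ℓ = Df(Y)` this is the integrand identity of §5.
[cite: Varadarajan1989, §6.3] [cite: Hall2015, §3.6, Prop. 3.24] -/
theorem boost_jets_sum_eq_radial (B : Matrix (Fin 2) (Fin 2) ℂ →L[ℝ] Matrix (Fin 2) (Fin 2) ℂ →L[ℝ] E) (ℓ : Matrix (Fin 2) (Fin 2) ℂ →L[ℝ] E)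
    {p q : ℝ} (hpq : p * q = 1) (e : Fin 2 → ℂ) (he : ∀ k, e k ≠ 0) (hereal : ∀ k, conj (e k) = e k) (hqe : (q : ℂ) ^ 2 * e 1 = -e 0)
    {T T' : Matrix (Fin 2) (Fin 2) ℂ} (hTH : Tᴴ * Matrix.diagonal e * T = Matrix.diagonal e) (hTT' : T * T' = 1)
    (z : ℂ) (ψ : ℝ) {M : Matrix (Fin 2) (Fin 2) ℂ} (hM : M = Matrix.diagonal ![z * cexp (ψ * I), z * cexp (-(ψ * I))]) :
    B (T * (!![(0 : ℂ), (p : ℂ); (q : ℂ), 0] * M - M * !![(0 : ℂ), (p : ℂ); (q : ℂ), 0]) * T') (T * (!![(0 : ℂ), (p : ℂ); (q : ℂ), 0] * M - M * !![(0 : ℂ), (p : ℂ); (q : ℂ), 0]) * T') +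
          ℓ (T * ((2 : ℂ) • M - (2 : ℂ) • (!![(0 : ℂ), (p : ℂ); (q : ℂ), 0] * M * !![(0 : ℂ), (p : ℂ); (q : ℂ), 0])) * T') +
        (B (T * (!![(0 : ℂ), -((p : ℂ) * I); (q : ℂ) * I, 0] * M - M * !![(0 : ℂ), -((p : ℂ) * I); (q : ℂ) * I, 0]) * T') (T * (!![(0 : ℂ), -((p : ℂ) * I); (q : ℂ) * I, 0] * M - M * !![(0 : ℂ), -((p : ℂ) * I); (q : ℂ) * I, 0]) * T') +
          ℓ (T * ((2 : ℂ) • M - (2 : ℂ) • (!![(0 : ℂ), -((p : ℂ) * I); (q : ℂ) * I, 0] * M * !![(0 : ℂ), -((p : ℂ) * I); (q : ℂ) * I, 0])) * T')) =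
      (2 - 2 * Real.cos (2 * ψ)) •
          ((-(B (T * M * T' * !![I, 0; 0, -I]) (T * M * T' * !![I, 0; 0, -I]) + ℓ (T * M * T' * !![I, 0; 0, -I] * !![I, 0; 0, -I])) +
              (B (T * M * T' * !![(0 : ℂ), (p : ℂ); (q : ℂ), 0]) (T * M * T' * !![(0 : ℂ), (p : ℂ); (q : ℂ), 0]) + ℓ (T * M * T' * !![(0 : ℂ), (p : ℂ); (q : ℂ), 0] * !![(0 : ℂ), (p : ℂ); (q : ℂ), 0])) +
              (B (T * M * T' * !![(0 : ℂ), -((p : ℂ) * I); (q : ℂ) * I, 0]) (T * M * T' * !![(0 : ℂ), -((p : ℂ) * I); (q : ℂ) * I, 0]) + ℓ (T * M * T' * !![(0 : ℂ), -((p : ℂ) * I); (q : ℂ) * I, 0] * !![(0 : ℂ), -((p : ℂ) * I); (q : ℂ) * I, 0]))) +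
            (B (T * (M * !![I, 0; 0, -I]) * T') (T * (M * !![I, 0; 0, -I]) * T') + ℓ (T * (M * !![I, 0; 0, -I] * !![I, 0; 0, -I]) * T'))) +
        (4 * Real.sin (2 * ψ)) • ℓ (T * (M * !![I, 0; 0, -I]) * T') := by
  subst hM
  have hT'T : T' * T = 1 := mul_eq_one_comm.1 hTT'
  obtain ⟨hb, ha', hCS⟩ := torusPoint_rel z ψ
  -- the boost jets as REAL combinations, conjugated (★ Z1 §3)
  have e2' : T * (!![(0 : ℂ), (p : ℂ); (q : ℂ), 0] * Matrix.diagonal ![z * cexp (ψ * I), z * cexp (-(ψ * I))] - Matrix.diagonal ![z * cexp (ψ * I), z * cexp (-(ψ * I))] * !![(0 : ℂ), (p : ℂ); (q : ℂ), 0]) * T' =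
      (Real.cos (2 * ψ) - 1) • (T * (Matrix.diagonal ![z * cexp (ψ * I), z * cexp (-(ψ * I))] * !![(0 : ℂ), (p : ℂ); (q : ℂ), 0]) * T') +
        Real.sin (2 * ψ) • (T * (Matrix.diagonal ![z * cexp (ψ * I), z * cexp (-(ψ * I))] * !![(0 : ℂ), -((p : ℂ) * I); (q : ℂ) * I, 0]) * T') := by
    rw [Xh₂_mul_sub_mul_Xh₂ p q hb ha', conj_add_smul]
  have e3' : T * (!![(0 : ℂ), -((p : ℂ) * I); (q : ℂ) * I, 0] * Matrix.diagonal ![z * cexp (ψ * I), z * cexp (-(ψ * I))] - Matrix.diagonal ![z * cexp (ψ * I), z * cexp (-(ψ * I))] * !![(0 : ℂ), -((p : ℂ) * I); (q : ℂ) * I, 0]) * T' =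
      (-Real.sin (2 * ψ)) • (T * (Matrix.diagonal ![z * cexp (ψ * I), z * cexp (-(ψ * I))] * !![(0 : ℂ), (p : ℂ); (q : ℂ), 0]) * T') +
        (Real.cos (2 * ψ) - 1) • (T * (Matrix.diagonal ![z * cexp (ψ * I), z * cexp (-(ψ * I))] * !![(0 : ℂ), -((p : ℂ) * I); (q : ℂ) * I, 0]) * T') := by
    rw [Xh₃_mul_sub_mul_Xh₃ p q hb ha', conj_add_smul]
  have e2'' : T * ((2 : ℂ) • Matrix.diagonal ![z * cexp (ψ * I), z * cexp (-(ψ * I))] -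
      (2 : ℂ) • (!![(0 : ℂ), (p : ℂ); (q : ℂ), 0] * Matrix.diagonal ![z * cexp (ψ * I), z * cexp (-(ψ * I))] * !![(0 : ℂ), (p : ℂ); (q : ℂ), 0])) * T' =
      (2 - 2 * Real.cos (2 * ψ)) • (T * Matrix.diagonal ![z * cexp (ψ * I), z * cexp (-(ψ * I))] * T') +
        (2 * Real.sin (2 * ψ)) • (T * (Matrix.diagonal ![z * cexp (ψ * I), z * cexp (-(ψ * I))] * !![I, 0; 0, -I]) * T') := by
    rw [two_smul_sub_two_smul_Xh₂_conj hpq hb ha', conj_add_smul]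
  have e3'' : T * ((2 : ℂ) • Matrix.diagonal ![z * cexp (ψ * I), z * cexp (-(ψ * I))] -
      (2 : ℂ) • (!![(0 : ℂ), -((p : ℂ) * I); (q : ℂ) * I, 0] * Matrix.diagonal ![z * cexp (ψ * I), z * cexp (-(ψ * I))] * !![(0 : ℂ), -((p : ℂ) * I); (q : ℂ) * I, 0])) * T' =
      (2 - 2 * Real.cos (2 * ψ)) • (T * Matrix.diagonal ![z * cexp (ψ * I), z * cexp (-(ψ * I))] * T') +
        (2 * Real.sin (2 * ψ)) • (T * (Matrix.diagonal ![z * cexp (ψ * I), z * cexp (-(ψ * I))] * !![I, 0; 0, -I]) * T') := by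
    rw [two_smul_sub_two_smul_Xh₃_conj hpq hb ha', conj_add_smul]
  rw [e2', e3', e2'', e3'']
  simp only [map_add, map_smul, _root_.add_apply, _root_.smul_apply]
  -- the Casimir seen by `(A, C) ↦ B(Y A, Y C)`, `Y = TMT′` (★ Z1 §6)
  have hconj : ∀ X : Matrix (Fin 2) (Fin 2) ℂ, T * Matrix.diagonal ![z * cexp (ψ * I), z * cexp (-(ψ * I))] * T' * (T * X * T') =
      T * (Matrix.diagonal ![z * cexp (ψ * I), z * cexp (-(ψ * I))] * X) * T' := fun X => by
    simp only [Matrix.mul_assoc]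
    rw [← Matrix.mul_assoc T' T, hT'T, Matrix.one_mul]
  have cas := casimir_conj_eq (LinearMap.mk₂ ℝ
      (fun A C => B (T * Matrix.diagonal ![z * cexp (ψ * I), z * cexp (-(ψ * I))] * T' * A) (T * Matrix.diagonal ![z * cexp (ψ * I), z * cexp (-(ψ * I))] * T' * C))
      (fun m₁ m₂ n => by simp only [Matrix.mul_add, map_add, _root_.add_apply])
      (fun c m n => by simp only [Matrix.mul_smul, map_smul, _root_.smul_apply])
      (fun m n₁ n₂ => by simp only [Matrix.mul_add, map_add])
      (fun c m n => by simp only [Matrix.mul_smul, map_smul])) hpq e he hereal hqe hTH hTT'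
  simp only [LinearMap.mk₂_apply, hconj] at cas
  -- first-order terms: `X₁² = −1`, `X̂_k² = 1`
  have f1 : T * Matrix.diagonal ![z * cexp (ψ * I), z * cexp (-(ψ * I))] * T' * !![I, 0; 0, -I] * !![I, 0; 0, -I] =
      -(T * Matrix.diagonal ![z * cexp (ψ * I), z * cexp (-(ψ * I))] * T') := by
    rw [Matrix.mul_assoc (T * _ * T'), X₁_mul_X₁, mul_neg, mul_one]
  have f2 : T * Matrix.diagonal ![z * cexp (ψ * I), z * cexp (-(ψ * I))] * T' * !![(0 : ℂ), (p : ℂ); (q : ℂ), 0] * !![(0 : ℂ), (p : ℂ); (q : ℂ), 0] =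
      T * Matrix.diagonal ![z * cexp (ψ * I), z * cexp (-(ψ * I))] * T' := by
    rw [Matrix.mul_assoc (T * _ * T'), Xh₂_mul_Xh₂ hpq, Matrix.mul_one]
  have f3 : T * Matrix.diagonal ![z * cexp (ψ * I), z * cexp (-(ψ * I))] * T' * !![(0 : ℂ), -((p : ℂ) * I); (q : ℂ) * I, 0] * !![(0 : ℂ), -((p : ℂ) * I); (q : ℂ) * I, 0] =
      T * Matrix.diagonal ![z * cexp (ψ * I), z * cexp (-(ψ * I))] * T' := by
    rw [Matrix.mul_assoc (T * _ * T'), Xh₃_mul_Xh₃ hpq, Matrix.mul_one]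
  have f4 : T * (Matrix.diagonal ![z * cexp (ψ * I), z * cexp (-(ψ * I))] * !![I, 0; 0, -I] * !![I, 0; 0, -I]) * T' =
      -(T * Matrix.diagonal ![z * cexp (ψ * I), z * cexp (-(ψ * I))] * T') := by
    rw [diagonal_mul_X₁_mul_X₁, Matrix.mul_neg, Matrix.neg_mul]
  rw [f1, f2, f3, f4, ℓ.map_neg]
  linear_combination (norm := module) (2 - 2 * Real.cos (2 * ψ)) • cas +
    hCS • (B (T * (Matrix.diagonal ![z * cexp (ψ * I), z * cexp (-(ψ * I))] * !![(0 : ℂ), (p : ℂ); (q : ℂ), 0]) * T') (T * (Matrix.diagonal ![z * cexp (ψ * I), z * cexp (-(ψ * I))] * !![(0 : ℂ), (p : ℂ); (q : ℂ), 0]) * T') +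
      B (T * (Matrix.diagonal ![z * cexp (ψ * I), z * cexp (-(ψ * I))] * !![(0 : ℂ), -((p : ℂ) * I); (q : ℂ) * I, 0]) * T') (T * (Matrix.diagonal ![z * cexp (ψ * I), z * cexp (-(ψ * I))] * !![(0 : ℂ), -((p : ℂ) * I); (q : ℂ) * I, 0]) * T'))

end Pointwise

end Literature.NumberTheory.Automorphic.RankOneCasimir
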